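import Mathlib

/-!
# A Borel fundamental domain exists for a free properly discontinuous action of a countable group

Kernel support for the blind cell pub-hodge-repro2 (seat p2), T5-ID §ID-4(b′): the measure on
`Γ\𝔹²` was built in `BallQuotientMeasure.lean` from a fundamental domain `D` taken as a hypothesis.
This file removes the hypothesis: a countable group `G` acting on a second-countable space `α` so that
every point has an open neighbourhood `U` with `g • U ∩ U = ∅` for `g ≠ 1` (the «evenly covered»
condition, which Mathlib derives from `ProperlyDiscontinuousSMul` + freeness on a locally compact
Hausdorff space) admits a Borel fundamental domain, for EVERY measure `μ` — Mathlib's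
`MeasureTheory.IsFundamentalDomain G s μ`.

The construction is the classical one: with `(V n)` a countable cover by such neighbourhoods,
`s := {x | ∃ n, x ∈ V n ∧ ∀ m < n, ∀ g, g • x ∉ V m}`; every orbit meets `V n` for a least `n`, meets it
in exactly one point (translates of `V n` are disjoint), and that point lies in `s`.
-/

namespace Summit.Ventures.HodgeRepro2.FundamentalDomainExists

open MeasureTheory Topology
open scoped Pointwise

variable {G α : Type*} [Group G] [Countable G] [MulAction G α] [TopologicalSpace α]
  [SecondCountableTopology α] [Nonempty α] [MeasurableSpace α] [OpensMeasurableSpace α]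
  [MeasurableConstSMul G α]

/-- **Existence of a Borel fundamental domain.** If every point of the second-countable space `α` has an
open neighbourhood `U` whose translates `g • U` (`g ≠ 1`) are disjoint from `U`, then the countable
group `G` has a measurable fundamental domain for every measure `μ` on `α`. -/
theorem exists_isFundamentalDomain_of_forall_exists_nhds (μ : Measure α)
    (h : ∀ x : α, ∃ U ∈ 𝓝 x, IsOpen U ∧ ∀ g : G, g ≠ 1 → Disjoint (g • U) U) :
    ∃ s : Set α, MeasurableSet s ∧ IsFundamentalDomain G s μ := by
  classical
  choose U hUx hUo hUd using h
  obtain ⟨T, hTc, hTU⟩ := TopologicalSpace.countable_cover_nhds hUx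
  obtain ⟨e, hTe⟩ := Set.countable_iff_exists_subset_range.mp hTc
  set V : ℕ → Set α := fun n => U (e n) with hV
  have hVo : ∀ n, IsOpen (V n) := fun n => hUo _
  have hVd : ∀ n (g : G), g ≠ 1 → Disjoint (g • V n) (V n) := fun n g hg => hUd _ g hg
  have hVcover : ∀ x, ∃ n, x ∈ V n := by
    intro x
    have hx : x ∈ ⋃ y ∈ T, U y := by rw [hTU]; exact Set.mem_univ x
    obtain ⟨y, hyT, hxy⟩ := Set.mem_iUnion₂.mp hx
    obtain ⟨n, rfl⟩ := hTe hyT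
    exact ⟨n, hxy⟩
  let s : Set α := {x | ∃ n, x ∈ V n ∧ ∀ m < n, ∀ g : G, g • x ∉ V m}
  have hs : MeasurableSet s := by
    have hrepr : s = ⋃ n, (V n ∩ ⋂ m, ⋂ (_ : m < n), ⋂ g : G, (fun x => g • x) ⁻¹' (V m)ᶜ) := by
      ext x
      simp only [s, Set.mem_setOf_eq, Set.mem_iUnion, Set.mem_inter_iff, Set.mem_iInter,
        Set.mem_preimage, Set.mem_compl_iff]
    rw [hrepr]
    refine MeasurableSet.iUnion fun n => (hVo n).measurableSet.inter ?_
    refine MeasurableSet.iInter fun m => MeasurableSet.iInter fun _ => MeasurableSet.iInter fun g => ?_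
    exact (hVo m).measurableSet.compl.preimage (measurable_const_smul g)
  refine ⟨s, hs, IsFundamentalDomain.mk' hs.nullMeasurableSet fun x => ?_⟩
  have hex : ∃ n, ∃ g : G, g • x ∈ V n := by
    obtain ⟨n, hn⟩ := hVcover x
    exact ⟨n, 1, by simpa using hn⟩
  obtain ⟨g₀, hg₀⟩ := Nat.find_spec hex
  have hmin : ∀ m < Nat.find hex, ∀ g : G, g • x ∉ V m :=
    fun m hm g hg => Nat.find_min hex hm ⟨g, hg⟩
  refine ⟨g₀, ⟨Nat.find hex, hg₀, fun m hm g hg => hmin m hm (g * g₀) (by rwa [mul_smul])⟩, ?_⟩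
  rintro g ⟨n', hgn', hg'⟩
  have h1 : Nat.find hex ≤ n' := Nat.find_min' hex ⟨g, hgn'⟩
  have h2 : ¬ Nat.find hex < n' := fun hlt =>
    hg' _ hlt (g₀ * g⁻¹) (by rw [mul_smul, inv_smul_smul]; exact hg₀)
  have hnn : n' = Nat.find hex := le_antisymm (not_lt.mp h2) h1
  rw [hnn] at hgn'
  by_contra hne
  have hne' : g * g₀⁻¹ ≠ 1 := fun h => hne (mul_inv_eq_one.mp h)
  have hmem : g • x ∈ (g * g₀⁻¹) • V (Nat.find hex) :=
    ⟨g₀ • x, hg₀, by simp only [mul_smul, inv_smul_smul]⟩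
  exact Set.disjoint_left.mp (hVd _ _ hne') hmem hgn'

/-- **Fundamental domains for properly discontinuous free actions.** On a locally compact Hausdorff
second-countable space, a countable group acting properly discontinuously (Mathlib's
`ProperlyDiscontinuousSMul`), freely (`IsCancelSMul`) and continuously has a Borel fundamental domain
for every measure. -/
theorem exists_isFundamentalDomain_of_properlyDiscontinuousSMul [LocallyCompactSpace α] [T2Space α]
    [ContinuousConstSMul G α] [ProperlyDiscontinuousSMul G α] [IsCancelSMul G α] (μ : Measure α) :
    ∃ s : Set α, MeasurableSet s ∧ IsFundamentalDomain G s μ := by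
  refine exists_isFundamentalDomain_of_forall_exists_nhds μ fun x => ?_
  obtain ⟨U, hU, hdisj⟩ := ProperlyDiscontinuousSMul.exists_nhds_image_smul_eq_self G x
  refine ⟨interior U, interior_mem_nhds.mpr hU, isOpen_interior, fun g hg => ?_⟩
  rw [Set.disjoint_left]
  rintro y ⟨z, hz, rfl⟩ hy
  have hne : ((fun x => g • x) '' U ∩ U).Nonempty :=
    ⟨g • z, ⟨z, interior_subset hz, rfl⟩, interior_subset hy⟩
  exact hg (isCancelSMul_iff_eq_one_of_smul_eq.mp ‹IsCancelSMul G α› _ _ (hdisj g hne))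

end Summit.Ventures.HodgeRepro2.FundamentalDomainExists
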